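import Summits.QuantumFields.YangMills.Theorems.BalabanUVNodesSpineCarriersOfRecord13CoPR
import Literature.MathematicalPhysics.QuantumFieldTheory.Balaban1983to89.Node00.Record13DatumKeyCoPR

/-! v1.6 `CoPR` EDITION (FINDING №8; director-ym №169∕№174; def-T FILE 25 `Node00/Record13CoPR.lean` p529474 ✓ KEY-RULE-25; RR-2 `Node00/Record13DatumKeyCoPR.lean` ✓; dag-n27-c (D)ᶜᵒᴾᴿ
`…SpineCarriersOfRecord13CoPR` ✓) OF dag-n20-d's `…SpineCarriersOfRecord13Keyed` ((T-SPINE)₁₃ LAYER A + THE CANONICAL KEY), filed FOR THE n20 LINEAGE by dag-n19-d g8 — the image of my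
LANDED (E′)ᴾ `…SpineCarriersOfRecord13CoPKeyed` (p525929 ✓) under KEY-RULE-25 (`θ : Stage13RParams`, key `Provisos₁₃CoPR`, `datumOfRecord₁₃CoPR`, `IsRecordOfRecord₁₃CCoPR`, RR-2's
`IsDatumOfRecord₁₃CCoPR` ∕ `canon₁₃CoPR` ∕ `exists_keyed_canon₁₃CoPR_iff`, stems `…₁₃CoPR`); namespace UNCHANGED (`YMDAG.UVSplit`, theirs); θ-level `Node00.SpineAssignment₁₃` NOT twinned.  Lane
`--kind definition --supports stmt-QuantumFields-20509 --as helper` (two defs; K3⁶).  COUNT-NEUTRAL; nothing of Bałaban's asserted; no record inhabitant claimed.  Below: n20-d's header under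
the map. -/
/-!
# THE SPINE-CARRIER PREDICATE OF RECORD AT STAGE 13, KEYED — layer A of the rate-record home at ₁₃ (node00-def-RR-2's residual `Node00.SpineAssignment₁₃` READ AS
# a reading) and THE CANONICAL KEY (`YMDAG.UVSplit.canonReading₁₃CoPR`: a reading READ THROUGH RR-2's `Node00.canon₁₃CoPR` pins ONE bundle per datum of record, at its
# canonical parameter `Node00.IsDatumOfRecord₁₃CCoPR.params` — the SAME parameter (T-RATE)'s datum-keyed `RRec₁₃CoPR` reads); the ₁₃ twin of
# `BalabanUVNodesSpineCarriersOfRecord12Keyed` (p466628), sibling of `BalabanUVNodesSpineCarriersOfRecord13CoPR` (the 400-line rule)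

Track A of `YM-PLAN.md` (cell `pub-ymgap`, HUMAN RULING D-0062); seat `pub-ymgap-dag-n20-d` (generation 4), module 5 of the ₁₃ re-key of the n20 lineage
(director-ym LINE №125 «RECORD 13»; node00-def-RR-2's `R13-KEY-TOKEN-MAP.md` «n20-d pens»); RR-2's `Node00/Record13DatumKeyCoPR.lean` (`IsDatumOfRecord₁₃CCoPR`,
`.params ∕ .provisos ∕ .admissible`, `canon₁₃CoPR`, `exists_keyed_canon₁₃CoPR_iff`, `SpineAssignment₁₃`, `SpineAssignment₁₃.ofStage12 ∕ .ofStage9`) consumed BY NAME,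
nothing re-typed.  Definition lane (two `def`s); every theorem kernel bookkeeping; 0 `sorry`, standard axioms.  COUNT-NEUTRAL; `--supports` K3′
(stmt-QuantumFields-19908, `--as helper`) until the rev-16 ids over `Stage13RParams` exist.  Restate-immune (no Theses import).

WHAT THIS MODULE PROVES (all [bookkeeping]; the ₁₂ module with `12 ↦ 13` plus the `.ofStage12` lift face).
* §1 LAYER A AT ₁₃: `readingOfAssignment₁₃CoPR 𝔰` · `sRec₁₃CoPR_assignment_iff` (`Iff.rfl`) · `s_N20 ∕ s_N21 ∕ s_N19 ∕ s_U4_sRec₁₃CoPR_assignment_iff` ·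
  `readingOfAssignment₁₃CoPR_ofStage9_apply` · `readingOfAssignment₁₃CoPR_ofStage12_apply` (a Stage-12-typed assignment lifts, `rfl`).
* §2 THE CANONICAL KEY AT ₁₃: `canonReading₁₃CoPR cr` · `sRec₁₃CoPR_canon_iff` (RR-2's `exists_keyed_canon₁₃CoPR_iff` at `Φ x := S = x g₀ os`) · `sRec₁₃CoPR_canon_unique` ·
  `s_N20_sRec₁₃CoPR_canon_iff` · `s_N20_sRec₁₃CoPR_canon_of_sRec₁₃CoPR` · `sRec₁₃CoPR_canon_of_isRecordOfRecord₁₃CCoPR`.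

HONEST FRAMING.  PINS ONLY; nothing of Bałaban's is asserted or instantiated; NE7 ∕ NE7b ∕ NE7c NOT PRINTED for d = 4, NOT PROVED; no inhabitant of
`IsRecordOfRecord₁₃CCoPR` ∕ `IsDatumOfRecord₁₃CCoPR` claimed (K0‴ open); N19 ∕ N20 ∕ N21 ∕ N27 NOT discharged (0∕1 at every record); typed 28∕28, discharged count
untouched; one finite four-torus programme at fixed `ε` — NOT ℝ⁴, NOT infinite volume, NOT OS, NOT a mass gap, NOT Clay.  No decl below carries a cite tag.
-/


open Finset

namespace YMDAG.UVSplit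

open Literature.MathematicalPhysics.QuantumFieldTheory.Balaban1983to89
open Literature.MathematicalPhysics.QuantumFieldTheory.Balaban1983to89.T4Continuum
open T4WeightBudget (RelWeightBound)
open T4IndicatorShell (ShellWeightBound)
open Summit.QuantumFields.BalabanUV.T4Continuum.Spine
open Node00 (Stage13RParams datumOfRecord₁₃CoPR IsRecordOfRecord₁₃CCoPR)

variable {N : ℕ} [NeZero N] (cr : SpineReading₁₃CoPR N)

/-! ## §1 LAYER A AT ₁₃ — node00-def-RR-2's `Node00/Record13DatumKeyCoPR.lean`: the residual `Node00.SpineAssignment₁₃ N` READ AS a reading (RR-1's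
stage-free objects `Node00.SpineObjects₁₁`, carried to `SpineCarriers` by p456575's `spineOfObjects₁₁`, REUSED by import); the instances restated at the
assignment's own fields -/

section LayerA

/-- **THE READING OF A RESIDUAL STAGE-13 SPINE ASSIGNMENT** `𝔰 : Node00.SpineAssignment₁₃ N` (RR-2: `(F, θ, g₀, os) ↦ SpineObjects₁₁`, proviso-free):
`(F, θ, hP, g₀, os) ↦ spineOfObjects₁₁ (𝔰 F θ.toStage13Params g₀ os)` — the provisos proof is not read.  `SRec₁₃CoPR (readingOfAssignment₁₃CoPR 𝔰)` is layer A's «`SRec₁₃CoPR 𝔰`». [bookkeeping] -/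
def readingOfAssignment₁₃CoPR (𝔰 : Node00.SpineAssignment₁₃ N) : SpineReading₁₃CoPR N :=
  fun F θ _ g₀ os => spineOfObjects₁₁ (𝔰 F θ.toStage13Params g₀ os)

variable (𝔰 : Node00.SpineAssignment₁₃ N)

/-- Unfolding at an assignment (`Iff.rfl`). [bookkeeping] -/
theorem sRec₁₃CoPR_assignment_iff {F : T4Family} (D : Datum F N) (g₀ : ℕ → ℝ) (os : List (ULoop F)) (S : SpineCarriers) :
    SRec₁₃CoPR (readingOfAssignment₁₃CoPR 𝔰) F D g₀ os S ↔
      ∃ (θ : Stage13RParams F N) (hP : θ.Provisos₁₃CoPR F N), θ.Admissible F N ∧ D = datumOfRecord₁₃CoPR F N θ hP ∧ S = spineOfObjects₁₁ (𝔰 F θ.toStage13Params g₀ os) :=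
  Iff.rfl

/-- **N20 AT LAYER A's OBJECTS, STAGE 13**: `S_N20 (SRec₁₃CoPR (readingOfAssignment₁₃CoPR 𝔰))` ⟺ «for every admissible Stage-13 θ with provisos, every `g₀`, `os`:
NE7b's `RelWeightBound` at the FIELDS `l₀, T, A, B, Bad, W` of `𝔰 F θ.toStage13Params g₀ os`» (`s_N20_sRec₁₃CoPR_iff`, fields by `rfl`). [bookkeeping] -/
theorem s_N20_sRec₁₃CoPR_assignment_iff :
    S_N20 (SRec₁₃CoPR (readingOfAssignment₁₃CoPR 𝔰)) ↔ ∀ (F : T4Family) (θ : Stage13RParams F N) (_ : θ.Provisos₁₃CoPR F N), θ.Admissible F N →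
      ∀ (g₀ : ℕ → ℝ) (os : List (ULoop F)),
        RelWeightBound (𝔰 F θ.toStage13Params g₀ os).l₀ (𝔰 F θ.toStage13Params g₀ os).T (𝔰 F θ.toStage13Params g₀ os).A (𝔰 F θ.toStage13Params g₀ os).B (𝔰 F θ.toStage13Params g₀ os).Bad (𝔰 F θ.toStage13Params g₀ os).W :=
  s_N20_sRec₁₃CoPR_iff (readingOfAssignment₁₃CoPR 𝔰)

/-- **N21 AT LAYER A's OBJECTS, STAGE 13** (fields `l₀, T, A, B, shA, shB, Wsh`). [bookkeeping] -/
theorem s_N21_sRec₁₃CoPR_assignment_iff :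
    S_N21 (SRec₁₃CoPR (readingOfAssignment₁₃CoPR 𝔰)) ↔ ∀ (F : T4Family) (θ : Stage13RParams F N) (_ : θ.Provisos₁₃CoPR F N), θ.Admissible F N →
      ∀ (g₀ : ℕ → ℝ) (os : List (ULoop F)),
        ShellWeightBound (𝔰 F θ.toStage13Params g₀ os).l₀ (𝔰 F θ.toStage13Params g₀ os).T (𝔰 F θ.toStage13Params g₀ os).A (𝔰 F θ.toStage13Params g₀ os).B (𝔰 F θ.toStage13Params g₀ os).shA (𝔰 F θ.toStage13Params g₀ os).shB
          (𝔰 F θ.toStage13Params g₀ os).Wsh :=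
  s_N21_sRec₁₃CoPR_iff (readingOfAssignment₁₃CoPR 𝔰)

/-- **N19 AT LAYER A's OBJECTS, STAGE 13** (the cores `A − shA`, `B − shB`, the bad sets, `vol`, `δ`; `DecidableEq` = the record's `dec`). [bookkeeping] -/
theorem s_N19_sRec₁₃CoPR_assignment_iff (Inputs : InputsPred N) :
    S_N19 (SRec₁₃CoPR (readingOfAssignment₁₃CoPR 𝔰)) Inputs ↔ ∀ (F : T4Family) (θ : Stage13RParams F N) (hP : θ.Provisos₁₃CoPR F N), θ.Admissible F N →
      ∀ (g₀ : ℕ → ℝ) (os : List (ULoop F)), Inputs F (datumOfRecord₁₃CoPR F N θ hP) g₀ os → letI := (𝔰 F θ.toStage13Params g₀ os).dec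
        NE7.Core (𝔰 F θ.toStage13Params g₀ os).l₀ (𝔰 F θ.toStage13Params g₀ os).vol (𝔰 F θ.toStage13Params g₀ os).T (𝔰 F θ.toStage13Params g₀ os).Bad
          (fun K t τ => (𝔰 F θ.toStage13Params g₀ os).A K t τ - (𝔰 F θ.toStage13Params g₀ os).shA K t τ)
          (fun K t τ => (𝔰 F θ.toStage13Params g₀ os).B K t τ - (𝔰 F θ.toStage13Params g₀ os).shB K t τ) (𝔰 F θ.toStage13Params g₀ os).δ :=
  s_N19_sRec₁₃CoPR_iff (readingOfAssignment₁₃CoPR 𝔰) Inputs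

/-- **U4′ AT LAYER A's OBJECTS, STAGE 13** (fields `W, Wsh, δ`). [bookkeeping] -/
theorem s_U4_sRec₁₃CoPR_assignment_iff :
    S_U4 (SRec₁₃CoPR (readingOfAssignment₁₃CoPR 𝔰)) ↔ ∀ (F : T4Family) (θ : Stage13RParams F N) (_ : θ.Provisos₁₃CoPR F N), θ.Admissible F N →
      ∀ (g₀ : ℕ → ℝ) (os : List (ULoop F)), (∀ K, (𝔰 F θ.toStage13Params g₀ os).W K + (𝔰 F θ.toStage13Params g₀ os).Wsh K < 1) ∧ Summable (𝔰 F θ.toStage13Params g₀ os).δ :=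
  s_U4_sRec₁₃CoPR_iff (readingOfAssignment₁₃CoPR 𝔰)

/-- **A STAGE-9-TYPED ASSIGNMENT LIFTS** (RR-2's `SpineAssignment₁₃.ofStage9`): an assignment reading only the Stage-9 part of the tuple keys, at ₁₃, the reading
`(F, θ, hP, g₀, os) ↦ spineOfObjects₁₁ (s F θ.toStage9Params g₀ os)` (`rfl`). [bookkeeping] -/
theorem readingOfAssignment₁₃CoPR_ofStage9_apply (s : (F : T4Family) → Node00.Stage9Params F N → (ℕ → ℝ) → List (ULoop F) → Node00.SpineObjects₁₁)
    (F : T4Family) (θ : Stage13RParams F N) (hP : θ.Provisos₁₃CoPR F N) (g₀ : ℕ → ℝ) (os : List (ULoop F)) :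
    readingOfAssignment₁₃CoPR (Node00.SpineAssignment₁₃.ofStage9 N s) F θ hP g₀ os = spineOfObjects₁₁ (s F θ.toStage9Params g₀ os) :=
  rfl

/-- **A STAGE-12-TYPED ASSIGNMENT LIFTS** (RR-2's `SpineAssignment₁₃.ofStage12`): layer A's Stage-12 assignment keys, at ₁₃, the reading
`(F, θ, hP, g₀, os) ↦ spineOfObjects₁₁ (s F θ.toStage12Params g₀ os)` (`rfl`) — the one-token lift of RR-2's map §2. [bookkeeping] -/
theorem readingOfAssignment₁₃CoPR_ofStage12_apply (s : Node00.SpineAssignment₁₂ N) (F : T4Family) (θ : Stage13RParams F N) (hP : θ.Provisos₁₃CoPR F N)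
    (g₀ : ℕ → ℝ) (os : List (ULoop F)) :
    readingOfAssignment₁₃CoPR (Node00.SpineAssignment₁₃.ofStage12 N s) F θ hP g₀ os = spineOfObjects₁₁ (s F θ.toStage12Params g₀ os) :=
  rfl

end LayerA

/-! ## §2 THE CANONICAL KEY AT ₁₃ — node00-def-RR-2's `Node00.canon₁₃CoPR`: a reading READ THROUGH `canon₁₃CoPR` pins ONE bundle per datum of record
(`Node00.IsDatumOfRecord₁₃CCoPR.params`), so spine and rate carriers keyed independently ((T-RATE)'s `RRec₁₃CoPR 𝔯` is datum-keyed) are read AT THE SAME parameter -/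

section Canon

/-- **THE CANONICALISED READING, STAGE 13**: `cr` read at the canonical Stage-13 parameter of the datum `datumOfRecord₁₃CoPR F N θ hP` (RR-2's `Node00.canon₁₃CoPR`, choice;
off the datum-of-record class it reads `cr` itself). [bookkeeping] -/
noncomputable def canonReading₁₃CoPR (cr : SpineReading₁₃CoPR N) : SpineReading₁₃CoPR N :=
  fun F θ hP => Node00.canon₁₃CoPR F N (cr F) θ hP

/-- **THE DATUM-KEYED FACE**: keyed through the canonical reading, `SRec₁₃CoPR` pins at `(F, D, g₀, os)` exactly the bundle `cr` reads at the CANONICAL parameter of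
`D` — RR-2's `Node00.exists_keyed_canon₁₃CoPR_iff` at `Φ x := (S = x g₀ os)`. [bookkeeping] -/
theorem sRec₁₃CoPR_canon_iff {F : T4Family} (D : Datum F N) (g₀ : ℕ → ℝ) (os : List (ULoop F)) (S : SpineCarriers) :
    SRec₁₃CoPR (canonReading₁₃CoPR cr) F D g₀ os S ↔ ∃ h : Node00.IsDatumOfRecord₁₃CCoPR F N D, S = cr F h.params h.provisos g₀ os :=
  Node00.exists_keyed_canon₁₃CoPR_iff (f := cr F) (fun x => S = x g₀ os)

/-- **ONE BUNDLE PER DATUM**: through the canonical reading two pinned bundles at the same `(F, D, g₀, os)` coincide (proof irrelevance of the key). [bookkeeping] -/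
theorem sRec₁₃CoPR_canon_unique {F : T4Family} {D : Datum F N} {g₀ : ℕ → ℝ} {os : List (ULoop F)} {S S' : SpineCarriers}
    (h : SRec₁₃CoPR (canonReading₁₃CoPR cr) F D g₀ os S) (h' : SRec₁₃CoPR (canonReading₁₃CoPR cr) F D g₀ os S') : S = S' := by
  obtain ⟨k, rfl⟩ := (sRec₁₃CoPR_canon_iff cr D g₀ os S).mp h
  obtain ⟨k', rfl⟩ := (sRec₁₃CoPR_canon_iff cr D g₀ os S').mp h'
  rfl

/-- **N20 THROUGH THE CANONICAL KEY, STAGE 13**: `S_N20 (SRec₁₃CoPR (canonReading₁₃CoPR cr))` ⟺ «at every Stage-13 datum of record, NE7b's `RelWeightBound` at the bundle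
`cr` reads at the datum's CANONICAL parameter, for every `g₀`, `os`». [bookkeeping] -/
theorem s_N20_sRec₁₃CoPR_canon_iff :
    S_N20 (SRec₁₃CoPR (canonReading₁₃CoPR cr)) ↔ ∀ (F : T4Family) (D : Datum F N) (h : Node00.IsDatumOfRecord₁₃CCoPR F N D) (g₀ : ℕ → ℝ) (os : List (ULoop F)),
      RelWeightBound (cr F h.params h.provisos g₀ os).l₀ (cr F h.params h.provisos g₀ os).T (cr F h.params h.provisos g₀ os).A
        (cr F h.params h.provisos g₀ os).B (cr F h.params h.provisos g₀ os).Bad (cr F h.params h.provisos g₀ os).W := by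
  constructor
  · intro hS F D h g₀ os
    exact hS F D g₀ os _ ((sRec₁₃CoPR_canon_iff cr D g₀ os _).mpr ⟨h, rfl⟩)
  · intro hS F D g₀ os S hmem
    obtain ⟨h, rfl⟩ := (sRec₁₃CoPR_canon_iff cr D g₀ os S).mp hmem
    exact hS F D h g₀ os

/-- **THE θ-FORM IMPLIES THE CANONICAL FORM, STAGE 13**: NE7b at `cr`'s reading of EVERY admissible tuple with provisos (`S_N20 (SRec₁₃CoPR cr)`) gives it at the
canonical parameters (`S_N20 (SRec₁₃CoPR (canonReading₁₃CoPR cr))`) — the canonical reading's image lies in `cr`'s (p450743 `s_N20_of_image`). [bookkeeping] -/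
theorem s_N20_sRec₁₃CoPR_canon_of_sRec₁₃CoPR (h : S_N20 (SRec₁₃CoPR cr)) : S_N20 (SRec₁₃CoPR (canonReading₁₃CoPR cr)) := by
  rw [s_N20_sRec₁₃CoPR_canon_iff]
  intro F D hD g₀ os
  exact (s_N20_sRec₁₃CoPR_iff cr).mp h F hD.params hD.provisos hD.admissible g₀ os

/-- **AT A STAGE-13 RECORD PAIR THE CANONICAL READING IS PINNED** (RR-2's `isDatumOfRecord₁₃CCoPR_of_isRecordOfRecord₁₃CCoPR`): for every `(g₀, os)` the bundle
`cr F h.params h.provisos g₀ os` of the pair's datum key `h` is pinned at `D` by `SRec₁₃CoPR (canonReading₁₃CoPR cr)`. [bookkeeping] -/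
theorem sRec₁₃CoPR_canon_of_isRecordOfRecord₁₃CCoPR {F : T4Family} {D : Datum F N} {w : DagBinding.WorldP} (hR : IsRecordOfRecord₁₃CCoPR F N D w)
    (g₀ : ℕ → ℝ) (os : List (ULoop F)) :
    SRec₁₃CoPR (canonReading₁₃CoPR cr) F D g₀ os
      (cr F (Node00.isDatumOfRecord₁₃CCoPR_of_isRecordOfRecord₁₃CCoPR hR).params (Node00.isDatumOfRecord₁₃CCoPR_of_isRecordOfRecord₁₃CCoPR hR).provisos g₀ os) :=
  (sRec₁₃CoPR_canon_iff cr D g₀ os _).mpr ⟨Node00.isDatumOfRecord₁₃CCoPR_of_isRecordOfRecord₁₃CCoPR hR, rfl⟩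

end Canon

end YMDAG.UVSplit
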